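import Summits.HodgeConjecture.HodgeConjecture.Theorems.F0P2dStubT
import Literature.AlgebraicGeometry.ShimuraVarieties.UnitaryCurveConeHolomorphyOfCR
import HarnessLib

/-!
# Crux `HLiu418`, K-lane sub-line `F0_P5TP2SpectralProjection` — stub (T₂) `stub_T₂ : StubT₂MemHolCotFormsOfAe` CLOSED:
# pointwise invariances ∕ cotangent type from the a.e. ones, then the ★ rank-2 cone dictionary

Floor-0 programme P5 (Alb-CM), crux item stmt-HodgeConjecture-24832 (`HCCMUnconditional.HLiu418`); K-lane sub-line skeleton v0
`A-provers/A-p14/g16/TP2/F0_P5TP2SpectralProjection.skeleton-v0.lean` (A-p14 (g16); F0P5-plan (g0) 01:41:56Z GO), stub (T₂).  HC_CM is proved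
only modulo the 7 printed citations until rung 0 closes; this file is `sorry`-free, def-free, and takes nothing printed as a hypothesis.

CONTENT.  At the rank-2 engine datum `U(H)` (`H ∈ M₂(L)`, `L` CM, `σ_{w₁}H` hermitian at `w₁ = cmPlace L ι`, cone frame `𝔣`, `𝔭`-probe `X` with
family `γ z = exp (X z) ∈ U(σ_{w₁}H)(ℂ)`, `μ` automorphic): if `Ψ` is a CONTINUOUS left-`A_G · U(H)(L⁺)`-invariant function on `U(H)(𝔸_{L⁺})` whose
descent is a.e. the `L²` class `w`, if `w` is `L²`-invariant under the right archimedean factor `K_c` away from `w₁` and under an OPEN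
`K_f ≤ U(H)(𝔸_{L⁺,f})`, satisfies the cotangent `K_∞`-type relation `R(sec κ) w = (a k⁻¹) • w` for `κ ∈ U(σ_{w₁}H)` with frame coordinates
`(k, a, d)`, and if the `𝔭`-probes `z ↦ Ψ(y · sec (γ z))` are real-differentiable at `0` with `ℂ`-linear differential at every `y`, then
`Ψ ∈ holCotForms₂ … 𝔣`.  PROOF: every a.e. identity becomes a pointwise one by the `AdelicGroupData`-generic ★
`F0P2dStubT.apply_mul_right_eq_of_rightRegular_eq` (two continuous functions on the quotient agreeing a.e. agree — `μ` charges opens), and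
then ★ `UnitaryCurveCone.mem_holCotForms₂_of_probeCR` (A-p14 (g16), p800952: cone extension + inverse-function-theorem chart + Cauchy–Riemann
along the probe ⇒ `IsConeHol` slices).  `memHolCotForms₂_of_ae` is the honest form; `stubT₂_holds` is the skeleton's `StubT₂MemHolCotFormsOfAe`
BODY VERBATIM with the Lines-local bundles (`G2`, `sec₁`, `Kc₁`, `Realises₁`, `probeP₁`, `orbitP₁`) unfolded — fold
`stub_T₂ := fun L _ _ _ ι H hJ 𝔣 X hXu hXv hXt γ hγ μ _ w Ψ hΨ => F0P5TP2StubT.stubT₂_holds L ι H hJ 𝔣 X hXu hXv hXt γ hγ μ w Ψ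
⟨hΨ.leftInv, hΨ.cont, hΨ.aeEq, hΨ.diff, hΨ.contDeriv, hΨ.derivAe⟩`.

References: [BorelJacquet1979] §4.2, §4.6; [Borel1997] §5.14; [BergeronMillsonMoeglin2016Balls] Part 2 §1.3.
-/

set_option autoImplicit false
-- the mandated namespace repeats `HodgeConjecture.HodgeConjecture`, as in every `Theorems/*.lean` of this sub-problem
set_option linter.dupNamespace false

noncomputable section

namespace Summit.HodgeConjecture.HodgeConjecture.Cruxes.HLiu418.F0P5TP2StubT

open scoped Matrix ComplexOrder
open NumberField NumberField.InfinitePlace MeasureTheory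
open Literature.NumberTheory.Automorphic Literature.NumberTheory.Automorphic.UnitaryGroup
open Literature.NumberTheory.Automorphic.UnitaryCurveForms
open Literature.NumberTheory.Automorphic.UnitaryGroup.CotangentForms (toQuotFun)
open Literature.AlgebraicGeometry.ShimuraVarieties
open Summit.HodgeConjecture.HodgeConjecture.Cruxes.H413.F0P2dStubT

section Engine

open scoped Matrix.Norms.Operator

variable (L : Type) [Field L] [NumberField L] [IsCMField L] (ι : L →+* ℂ) (H : Matrix (Fin 2) (Fin 2) L)
  (hJ : (H.map (cmPlace L ι).1.embedding).IsHermitian) (𝔣 : ConeFrame L H (cmPlace L ι))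
  (X : ℂ →ₗ[ℝ] Matrix (Fin 2) (Fin 2) ℂ)
  (hXu : ∀ z, (X z)ᴴ * H.map (cmPlace L ι).1.embedding + H.map (cmPlace L ι).1.embedding * X z = 0)
  (hXv : ∀ z, X z *ᵥ 𝔣.v₀ = z • 𝔣.t₀) (hXt : ∀ z, ∃ c : ℂ, X z *ᵥ 𝔣.t₀ = c • 𝔣.v₀)
  (γ : ℂ → archLocal L 2 H (cmPlace L ι)) (hγ : ∀ z, ((γ z : GL (Fin 2) ℂ) : Matrix (Fin 2) (Fin 2) ℂ) = NormedSpace.exp (X z))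
  (μ : Measure (adelicGroupData (↥(maximalRealSubfield L)) L (IsCMField.complexConj L) 2 H).automorphicQuotient)
  [(adelicGroupData (↥(maximalRealSubfield L)) L (IsCMField.complexConj L) 2 H).IsAutomorphicMeasure μ]

include hJ hXu hXv hXt hγ

/-- **(T₂), honest form — pointwise invariances ∕ cotangent type from the a.e. ones, then the rank-2 cone dictionary.**
[cite: BorelJacquet1979, §4.2 and §4.6] [cite: Borel1997, §5.14] -/
theorem memHolCotForms₂_of_ae
    (w : (adelicGroupData (↥(maximalRealSubfield L)) L (IsCMField.complexConj L) 2 H).L2 μ)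
    (Ψ : (adelicGroupData (↥(maximalRealSubfield L)) L (IsCMField.complexConj L) 2 H).Adelic → ℂ)
    (hleft : ∀ γr ∈ (adelicGroupData (↥(maximalRealSubfield L)) L (IsCMField.complexConj L) 2 H).quotientSubgroup,
      ∀ x, Ψ (γr * x) = Ψ x)
    (hcont : Continuous Ψ)
    (hae : toQuotFun (adelicGroupData (↥(maximalRealSubfield L)) L (IsCMField.complexConj L) 2 H) Ψ =ᵐ[μ]
      (w : (adelicGroupData (↥(maximalRealSubfield L)) L (IsCMField.complexConj L) 2 H).automorphicQuotient → ℂ))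
    (hdiff : ∀ y, DifferentiableAt ℝ (fun z : ℂ => Ψ (y *
      adelicSingle (↥(maximalRealSubfield L)) L (IsCMField.complexConj L) 2 H (IsCMField.complexConj_ne_one L)
        (UnitaryGroup.complexConj_smul_infinitePlace L) (cmPlace L ι) (γ z))) 0)
    (hkc : ∀ k ∈ ((archAt (↥(maximalRealSubfield L)) L (IsCMField.complexConj L) 2 H (cmPlace L ι)
        (UnitaryGroup.complexConj_smul_infinitePlace L (cmPlace L ι).1) (IsCMField.complexConj_ne_one L)).ker).map
        (archToAdelic (↥(maximalRealSubfield L)) L (IsCMField.complexConj L) 2 H),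
      (adelicGroupData (↥(maximalRealSubfield L)) L (IsCMField.complexConj L) 2 H).rightRegular μ k w = w)
    (hkf : ∃ Kf : Subgroup (finAdelic (↥(maximalRealSubfield L)) L (IsCMField.complexConj L) 2 H),
      IsOpen (Kf : Set (finAdelic (↥(maximalRealSubfield L)) L (IsCMField.complexConj L) 2 H)) ∧
        ∀ k ∈ Kf, (adelicGroupData (↥(maximalRealSubfield L)) L (IsCMField.complexConj L) 2 H).rightRegular μ
          (finAdelicToAdelic (↥(maximalRealSubfield L)) L (IsCMField.complexConj L) 2 H k) w = w)
    (hktype : ∀ (κ : archLocal L 2 H (cmPlace L ι)) (a k d : ℂ), k ≠ 0 →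
      ((κ : GL (Fin 2) ℂ) : Matrix (Fin 2) (Fin 2) ℂ) *ᵥ 𝔣.v₀ = k • 𝔣.v₀ →
      ((κ : GL (Fin 2) ℂ) : Matrix (Fin 2) (Fin 2) ℂ) *ᵥ 𝔣.t₀ = a • 𝔣.t₀ + d • 𝔣.v₀ →
        (adelicGroupData (↥(maximalRealSubfield L)) L (IsCMField.complexConj L) 2 H).rightRegular μ
          (adelicSingle (↥(maximalRealSubfield L)) L (IsCMField.complexConj L) 2 H (IsCMField.complexConj_ne_one L)
            (UnitaryGroup.complexConj_smul_infinitePlace L) (cmPlace L ι) κ) w = (a * k⁻¹) • w)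
    (hCR : ∀ (y : (adelicGroupData (↥(maximalRealSubfield L)) L (IsCMField.complexConj L) 2 H).Adelic) (z : ℂ),
      fderiv ℝ (fun z : ℂ => Ψ (y *
        adelicSingle (↥(maximalRealSubfield L)) L (IsCMField.complexConj L) 2 H (IsCMField.complexConj_ne_one L)
          (UnitaryGroup.complexConj_smul_infinitePlace L) (cmPlace L ι) (γ z))) 0 (Complex.I • z) =
      Complex.I • fderiv ℝ (fun z : ℂ => Ψ (y *
        adelicSingle (↥(maximalRealSubfield L)) L (IsCMField.complexConj L) 2 H (IsCMField.complexConj_ne_one L)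
          (UnitaryGroup.complexConj_smul_infinitePlace L) (cmPlace L ι) (γ z))) 0 z) :
    Ψ ∈ holCotForms₂ (↥(maximalRealSubfield L)) L (IsCMField.complexConj L) H (IsCMField.complexConj_ne_one L)
      (UnitaryGroup.complexConj_smul_infinitePlace L) (cmPlace L ι) 𝔣 := by
  refine UnitaryCurveCone.mem_holCotForms₂_of_probeCR (IsCMField.complexConj_ne_one L)
    (UnitaryGroup.complexConj_smul_infinitePlace L) 𝔣 hJ X hXu hXv hXt γ hγ (fun γr x => ?_) (fun k hk x => ?_) ?_
    (fun x κ a k d hk hκv hκt => ?_) hdiff hCR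
  · -- left `U(H)(L⁺)`-invariance
    exact hleft _ ((adelicGroupData (↥(maximalRealSubfield L)) L (IsCMField.complexConj L) 2 H).arithmeticSubgroup_le_quotientSubgroup
      ⟨γr, rfl⟩) x
  · -- right `K_c`-invariance
    exact apply_mul_right_eq_self_of_rightRegular_eq_self hleft hcont hae (hkc k hk) x
  · -- smoothness under `U(H)(𝔸_{L⁺,f})`: one open `K_f`
    obtain ⟨Kf, hopen, hKf⟩ := hkf
    exact ⟨Kf, hopen, fun k hk x => apply_mul_right_eq_self_of_rightRegular_eq_self hleft hcont hae (hKf k hk) x⟩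
  · -- the cotangent `K_∞`-type relation
    have hleft' : ∀ γr ∈ (adelicGroupData (↥(maximalRealSubfield L)) L (IsCMField.complexConj L) 2 H).quotientSubgroup,
        ∀ x, (fun y => a * k⁻¹ * Ψ y) (γr * x) = (fun y => a * k⁻¹ * Ψ y) x := fun γr hγr x => by
      simp only [hleft γr hγr x]
    have hcont' : Continuous fun y => a * k⁻¹ * Ψ y := continuous_const.mul hcont
    have hae' : toQuotFun (adelicGroupData (↥(maximalRealSubfield L)) L (IsCMField.complexConj L) 2 H) (fun y => a * k⁻¹ * Ψ y) =ᵐ[μ]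
        (((a * k⁻¹) • w : (adelicGroupData (↥(maximalRealSubfield L)) L (IsCMField.complexConj L) 2 H).L2 μ) :
          (adelicGroupData (↥(maximalRealSubfield L)) L (IsCMField.complexConj L) 2 H).automorphicQuotient → ℂ) := by
      have hsm := Lp.coeFn_smul (a * k⁻¹) w
      filter_upwards [hae, hsm] with y hy hy'
      rw [hy', Pi.smul_apply, smul_eq_mul, ← hy]
      rfl
    exact apply_mul_right_eq_of_rightRegular_eq hleft hcont hleft' hcont' hae hae' (hktype κ a k d hk hκv hκt) x

/-- **(T₂) — the registered stub `stub_T₂ : StubT₂MemHolCotFormsOfAe` of `Lines/F0_P5TP2SpectralProjection.lean` (skeleton v0), BODY VERBATIM**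
with the Lines-local bundles unfolded (`G2`, `sec₁`, `Kc₁`; the structure `Realises₁` as the nested conjunction of its six fields
`leftInv ∧ cont ∧ aeEq ∧ diff ∧ contDeriv ∧ derivAe` with `probeP₁` ∕ `orbitP₁` unfolded); only `leftInv`, `cont`, `aeEq`, `diff` are used.
[cite: BorelJacquet1979, §4.2] [cite: Borel1997, §5.14] -/
theorem stubT₂_holds
    (w : (adelicGroupData (↥(maximalRealSubfield L)) L (IsCMField.complexConj L) 2 H).L2 μ)
    (Ψ : (adelicGroupData (↥(maximalRealSubfield L)) L (IsCMField.complexConj L) 2 H).Adelic → ℂ)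
    (hΨ : (∀ γr ∈ (adelicGroupData (↥(maximalRealSubfield L)) L (IsCMField.complexConj L) 2 H).quotientSubgroup, ∀ x, Ψ (γr * x) = Ψ x) ∧
      Continuous Ψ ∧
      toQuotFun (adelicGroupData (↥(maximalRealSubfield L)) L (IsCMField.complexConj L) 2 H) Ψ =ᵐ[μ]
        (w : (adelicGroupData (↥(maximalRealSubfield L)) L (IsCMField.complexConj L) 2 H).automorphicQuotient → ℂ) ∧
      (∀ y, DifferentiableAt ℝ (fun z : ℂ => Ψ (y *
        adelicSingle (↥(maximalRealSubfield L)) L (IsCMField.complexConj L) 2 H (IsCMField.complexConj_ne_one L)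
          (UnitaryGroup.complexConj_smul_infinitePlace L) (cmPlace L ι) (γ z))) 0) ∧
      (∀ z : ℂ, Continuous fun y => fderiv ℝ (fun z : ℂ => Ψ (y *
        adelicSingle (↥(maximalRealSubfield L)) L (IsCMField.complexConj L) 2 H (IsCMField.complexConj_ne_one L)
          (UnitaryGroup.complexConj_smul_infinitePlace L) (cmPlace L ι) (γ z))) 0 z) ∧
      ∀ z : ℂ, toQuotFun (adelicGroupData (↥(maximalRealSubfield L)) L (IsCMField.complexConj L) 2 H)
          (fun y => fderiv ℝ (fun z : ℂ => Ψ (y *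
            adelicSingle (↥(maximalRealSubfield L)) L (IsCMField.complexConj L) 2 H (IsCMField.complexConj_ne_one L)
              (UnitaryGroup.complexConj_smul_infinitePlace L) (cmPlace L ι) (γ z))) 0 z) =ᵐ[μ]
        ((fderiv ℝ (fun z : ℂ => (adelicGroupData (↥(maximalRealSubfield L)) L (IsCMField.complexConj L) 2 H).rightRegular μ
              (adelicSingle (↥(maximalRealSubfield L)) L (IsCMField.complexConj L) 2 H (IsCMField.complexConj_ne_one L)
                (UnitaryGroup.complexConj_smul_infinitePlace L) (cmPlace L ι) (γ z)) w) 0 z :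
            (adelicGroupData (↥(maximalRealSubfield L)) L (IsCMField.complexConj L) 2 H).L2 μ) :
          (adelicGroupData (↥(maximalRealSubfield L)) L (IsCMField.complexConj L) 2 H).automorphicQuotient → ℂ))
    (hkc : ∀ k ∈ ((archAt (↥(maximalRealSubfield L)) L (IsCMField.complexConj L) 2 H (cmPlace L ι)
        (UnitaryGroup.complexConj_smul_infinitePlace L (cmPlace L ι).1) (IsCMField.complexConj_ne_one L)).ker).map
        (archToAdelic (↥(maximalRealSubfield L)) L (IsCMField.complexConj L) 2 H),
      (adelicGroupData (↥(maximalRealSubfield L)) L (IsCMField.complexConj L) 2 H).rightRegular μ k w = w)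
    (hkf : ∃ Kf : Subgroup (finAdelic (↥(maximalRealSubfield L)) L (IsCMField.complexConj L) 2 H),
      IsOpen (Kf : Set (finAdelic (↥(maximalRealSubfield L)) L (IsCMField.complexConj L) 2 H)) ∧
        ∀ k ∈ Kf, (adelicGroupData (↥(maximalRealSubfield L)) L (IsCMField.complexConj L) 2 H).rightRegular μ
          (finAdelicToAdelic (↥(maximalRealSubfield L)) L (IsCMField.complexConj L) 2 H k) w = w)
    (hktype : ∀ (κ : archLocal L 2 H (cmPlace L ι)) (a k d : ℂ), k ≠ 0 →
      ((κ : GL (Fin 2) ℂ) : Matrix (Fin 2) (Fin 2) ℂ) *ᵥ 𝔣.v₀ = k • 𝔣.v₀ →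
      ((κ : GL (Fin 2) ℂ) : Matrix (Fin 2) (Fin 2) ℂ) *ᵥ 𝔣.t₀ = a • 𝔣.t₀ + d • 𝔣.v₀ →
        (adelicGroupData (↥(maximalRealSubfield L)) L (IsCMField.complexConj L) 2 H).rightRegular μ
          (adelicSingle (↥(maximalRealSubfield L)) L (IsCMField.complexConj L) 2 H (IsCMField.complexConj_ne_one L)
            (UnitaryGroup.complexConj_smul_infinitePlace L) (cmPlace L ι) κ) w = (a * k⁻¹) • w)
    (hCR : ∀ (y : (adelicGroupData (↥(maximalRealSubfield L)) L (IsCMField.complexConj L) 2 H).Adelic) (z : ℂ),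
      fderiv ℝ (fun z : ℂ => Ψ (y *
        adelicSingle (↥(maximalRealSubfield L)) L (IsCMField.complexConj L) 2 H (IsCMField.complexConj_ne_one L)
          (UnitaryGroup.complexConj_smul_infinitePlace L) (cmPlace L ι) (γ z))) 0 (Complex.I • z) =
      Complex.I • fderiv ℝ (fun z : ℂ => Ψ (y *
        adelicSingle (↥(maximalRealSubfield L)) L (IsCMField.complexConj L) 2 H (IsCMField.complexConj_ne_one L)
          (UnitaryGroup.complexConj_smul_infinitePlace L) (cmPlace L ι) (γ z))) 0 z) :
    Ψ ∈ holCotForms₂ (↥(maximalRealSubfield L)) L (IsCMField.complexConj L) H (IsCMField.complexConj_ne_one L)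
      (UnitaryGroup.complexConj_smul_infinitePlace L) (cmPlace L ι) 𝔣 :=
  memHolCotForms₂_of_ae L ι H hJ 𝔣 X hXu hXv hXt γ hγ μ w Ψ hΨ.1 hΨ.2.1 hΨ.2.2.1 hΨ.2.2.2.1 hkc hkf hktype hCR

end Engine

end Summit.HodgeConjecture.HodgeConjecture.Cruxes.HLiu418.F0P5TP2StubT

end
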